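import Summits.QuantumFields.BalabanUV.Beta.GAN24.SymCorrectorZeroMode
import Summits.QuantumFields.BalabanUV.Beta.GAN24.CombLin4Transport
import Summits.QuantumFields.BalabanUV.Beta.GAN24.CombRelSourceHalfCharge
import Summits.QuantumFields.BalabanUV.Beta.GAN24.CombT2DriftEvenEnd
import Summits.QuantumFields.BalabanUV.Beta.CombChartTransportLevel
import Summits.QuantumFields.BalabanUV.Beta.GAN24.LinT2CoDressedStep

/-!
# `BalabanUV.Beta.GAN24.CombTransportZeroMode` — binder row G-an2-4 ∕ (CONV-C), TRANSFER-III (the (α-0) chain at row D1's literal of record (III′)), the (C)-row at the comb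
# data: **THE FOUR-SLOT TRANSPORT `𝒯₄` AT THE COMB DATA — its `LocStencil₂` class and joint `Lc`-covariance, the comb-chart linear step as the ROOTED bm-CHART linear step on
# `𝒯₄ T` (every level), and the charge-neutrality instance `zmode N (𝒯₄ T̃′♮_j) = zmode N (T̃′♮_j)` for the comb-chart `T₂` tower** — the SUPPLIES (`hX`, `hXcov`, the step
# identity, the neutrality) that the OWNER gan24-p1's (III′) twin of road-P2's one-step charge law `T2RecChargeStep` §1–§3 imports BY NAME (leaf prover
# `b2b-balaban-gan24-formalise-leaf-01`, gen 84; division of labour journal l.67313 ∕ l.67320; no existing file touched)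

NOT IN PRINT; OUR BOOKKEEPING ([folklore] compositions BY NAME: MY `SymCorrectorZeroMode` (the charge-neutrality letter), leaf-03's TT5 `SymCorrectorSockets` and (C-1)
`CombLin4Transport.unitK_conj_psiKS ∕ lin4_conj_psiKS`, an2's `CombChartTransportLevel.GcombSh_eq_conj_psiKS_KInvStep`, leaf-01 g80's `CombRelSourceHalfCharge.locStencil₂_unitS₂_T2RecOf_comb`,
the OWNER g46's `CombT2DriftEvenEnd.unitS₂_T2RecOf_comb_translate`, lit-balaban's `ExpKernelCalculus.biLoc_comp_decays ∕ comp_shiftK`; 0 `def`, 0 cited facts, 0 `def … : Prop`, 0 sorry).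
HONEST FRAMING (cell contract, verbatim): «discharging `BetaPertH` makes Bałaban's UV stability UNCONDITIONAL — a real constructive-QFT result; it is NOT the continuum limit and NOT the
Clay problem.»  HONEST DEPENDENCY (verbatim): «continuum YM on T⁴ ⇐ BetaPertH ∧ nine spine estimates (0/9 proved); BetaPertH ⇐ (D1) ∧ (D4) ∧ CAP+tail; G-an2-4 gates asym, D1 and
NE2/3/4.»

WHAT (`𝒯₄ T κ₁ u₁ κ₂ u₂ := Ψ̂ᵀ ∘ slotPsiS r n (slotPsiS r n T κ₁ u₁) κ₂ u₂ ∘ Ψ̂`, `Ψ̂ = psiKS r n`, left-first bracketing):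
* §0 (generic `0 < n`, `r ∈ box (d+1) n`) `slotPsiS_translate` (block covariance of the scalar slot transport), `slotPsiS_outer_translate` ∕ `slotPsiS_inner_translate` (both table
  transports keep joint `n`-covariance), `conj_psiKS_shiftK`, **`fourSlot_translate`**: `𝒯₄ T κ (u+n•t) κ′ (u′+n•t) = shiftK (−n•t) (𝒯₄ T κ u κ′ u′)`; `biLoc_conj_psiKS` (the
  `Ψ̂`-conjugate of a `BiLoc` kernel is `BiLoc`, rate `δ/4`, constant linear in `C`), `locStencil₂_conj_psiKS`, **`locStencil₂_fourSlot`**: `LocStencil₂ T C δ → ∃ C′, LocStencil₂ (𝒯₄ T) C′ (δ/4)`.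
* §1 (comb data: `n = Lc`, `Ψ̂_S = psiKS (ctrOff (d+1) Lc) Lc`, root `ctr (d+1) Lc`) **`lin4_unitK_GcombSh_eq_fourSlot`**: for every level `j`, scalar `c` and `LocStencil₂` table `T` (rate `> 0`),
  `lin4 c (unitK_j (GcombSh Lc j)) Lc T κ u κ′ u′ = lin4 c (unitK_j (coDressKBmAt (ctr (d+1) Lc) Lc (KInvStep Lc j))) Lc (𝒯₄ T) κ u κ′ u′` — the comb-chart linear step IS the rooted
  bm-chart linear step on the transported table (compose with leaf-06's `LinT2CoDressedStep.lin4_comb_coDressKBmAt` and §0 to move the dressing onto `𝒯₄ T`).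
  **`lin4_unitK_GcombSh_eq_lin4_dress_fourSlot`**: `= lin4 c (unitK_j (KInvStep Lc j)) Lc (𝔇_{ρ_c} (𝒯₄ T))` (table equality; ⨾ leaf-06's `lin4_comb_coDressKBmAt`).
* §2 **`inner_fourSlot_comb_member_eq`** ∕ **`zmode_fourSlot_comb_member_eq`**: for ANY sym record `tabs : SymTables d Lc`, all constants, every level `j`, every period `N`, every direction
  pair and EVERY leg pair, `zmode N (𝒯₄ T̃′♮_j) κ κ′ a b = zmode N (T̃′♮_j) κ κ′ a b`, `T̃′♮_j := unitS₂_j (T2RecOf d Lc (GcombSh Lc) (SpureCombOf tabs cE cVH cΛ) tabs.M cE₂ cB Tc tabs.vh₂S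
  tabs.mixFF j)` — so in the (III′) conservation criterion `CombChargeConservationRow.zfreeSym_sourceB_comb_iff` the member's charge may be read on its transport, and the criterion
  takes the (E) shape «forcing charge = `λ ·` (transported member's charge − its dressed charge)» once the OWNER's twin of `T2RecChargeStep.zmode_succ_eq` is in.
WHAT THIS IS NOT.  Asserts NO value of Bałaban's tables and NO value of any charge; does NOT type the `T2RecChargeStep` §1–§3 twin (the OWNER's, l.67313), NOT (d′)∕(d″) (engine question
E0, R-GAN24P1-51-E0), NOT the memo's letter (ii); the (III′) campaign is NOT asked (an2 W-4) — zero weight; NEVER «G-an2-4 closed» as (CONV-C); NOT D1, NOT `BetaPertH`, NOT continuum,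
NOT Clay; not in print.  `bears_on: R4-G`.  2026-08-27.
-/

noncomputable section

open Finset
open scoped BigOperators
open Literature.MathematicalPhysics.QuantumFieldTheory
open Literature.MathematicalPhysics.QuantumFieldTheory.Balaban1983to89
open Literature.MathematicalPhysics.QuantumFieldTheory.Balaban1983to89.Beta
open B12Sec2to5 (l1 l1_nonneg)
open ExpKernelCalculus (MKer BiLoc Decays comp shiftK comp_shiftK biLoc_comp_decays Zl Zl_nonneg)
open OneStepResolventKernel (Fib)
open OneStepKernelFamily (KInvStep)
open AffineAveraging (Site Form1 box toSite)
open AveragingContours (blk)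
open AveragingContoursRooted (ctr ctrOff ctrOff_mem_box)
open AxialProjector (blk_add_zsmul)
open BalabanCompositeJets (LocStencil₂)
open BalabanStepW2 (biLoc_le_mono)
open Summit.QuantumFields.BalabanUV.Beta.TameKernelCalculus (trK trK_trK trK_comp decays_trK biLoc_trK Spr)
open Summit.QuantumFields.BalabanUV.Beta.KernelWardRelative (gaugeWt)
open Summit.QuantumFields.BalabanUV.Beta.HessKerDressedUnits (unitK decays_unitK)
open Summit.QuantumFields.BalabanUV.Beta.SecondOrderUnits (unitS₂)
open Summit.QuantumFields.BalabanUV.Beta.AxialDressingRooted (coDressKBmAt coProjBmAtK dressKBmAt decays_coDressKBmAt_KInvStep)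
open Summit.QuantumFields.BalabanUV.Beta.GAN24.LinT2CoDressedStep (lin4_comb_coDressKBmAt)
open Summit.QuantumFields.BalabanUV.Beta.CompositeCorrectorKernel (kerBound)
open Summit.QuantumFields.BalabanUV.Beta.SpineRooted (T2RecOf)
open Summit.QuantumFields.BalabanUV.Beta.SymmetrisedStepJets (SymTables)
open Summit.QuantumFields.BalabanUV.Beta.CombChartStepJets (GcombSh SpureCombOf)
open Summit.QuantumFields.BalabanUV.Beta.CombChartTransportLevel (GcombSh_eq_conj_psiKS_KInvStep)
open Summit.QuantumFields.BalabanUV.Beta.SymCorrectorKernel (psiKS shiftK_psiKS decays_psiKS spr_psiKS)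
open Summit.QuantumFields.BalabanUV.Beta.SymCorrectorFace (faceWt faceWt_shift bondNbhd faceSum_shift slotPsiS slotPsiS_apply slotPsiS_apply_kernel)
open Summit.QuantumFields.BalabanUV.Beta.SymCorrectorSockets (locStencil₂_slotPsiS_outer locStencil₂_slotPsiS₂)
open Summit.QuantumFields.BalabanUV.Beta.GAN24.CombesThomas (sfStep smStep)
open Summit.QuantumFields.BalabanUV.Beta.GAN24.T2RecursionAffine (lin4)
open Summit.QuantumFields.BalabanUV.Beta.GAN24.BiStencilZeroMode (Tab zmode)
open Summit.QuantumFields.BalabanUV.Beta.GAN24.CombLin4Transport (unitK_conj_psiKS lin4_conj_psiKS)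
open Summit.QuantumFields.BalabanUV.Beta.GAN24.CombRelSourceHalfCharge (locStencil₂_unitS₂_T2RecOf_comb)
open Summit.QuantumFields.BalabanUV.Beta.GAN24.CombT2DriftEvenEnd (unitS₂_T2RecOf_comb_translate)
open Summit.QuantumFields.BalabanUV.Beta.GAN24.SymCorrectorZeroMode (slotPsiS_apply_table inner_fourSlot_eq zmode_fourSlot_eq)

namespace Summit.QuantumFields.BalabanUV.Beta.GAN24.CombTransportZeroMode

variable {d : ℕ}

/-! ## §0 The four-slot transport keeps joint block covariance and the `LocStencil₂` class (generic block side `n`, root offset `r`) -/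

section Generic

variable {n : ℕ} (hn : 0 < n) (r : Fin (d + 1) → ℕ)
include hn

/-- [folklore] **BLOCK COVARIANCE OF THE SCALAR SLOT TRANSPORT**: if `F′ k (v + n•t) = F k v` for all `k v`, then `slotPsiS r n F′ κ (u + n•t) = slotPsiS r n F κ u`
(`faceWt_shift`, `blk_add_zsmul`, `faceSum_shift`). -/
theorem slotPsiS_translate {F F' : Form1 (d + 1) ℝ} (t : Site (d + 1)) (hF : ∀ k v, F' k (v + (n : ℤ) • t) = F k v) (κ : Fin (d + 1)) (u : Site (d + 1)) :
    slotPsiS r n F' κ (u + (n : ℤ) • t) = slotPsiS r n F κ u := by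
  rw [slotPsiS_apply, slotPsiS_apply, faceWt_shift hn, blk_add_zsmul hn, hF]
  simp only [smul_eq_mul]
  congr 2
  refine Finset.sum_congr rfl fun k _ => ?_
  rw [faceSum_shift hn]
  exact Finset.sum_congr rfl fun v _ => by rw [hF]

variable {T : Fin (d + 1) → Site (d + 1) → Fin (d + 1) → Site (d + 1) → MKer (d + 1) (Fib d)}

/-- [folklore] **THE OUTER SLOT TRANSPORT KEEPS JOINT BLOCK COVARIANCE** of a bi-stencil table. -/
theorem slotPsiS_outer_translate (hTcov : ∀ κ u κ' u' t, T κ (u + (n : ℤ) • t) κ' (u' + (n : ℤ) • t) = shiftK (-((n : ℤ) • t)) (T κ u κ' u'))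
    (κ : Fin (d + 1)) (u : Site (d + 1)) (κ' : Fin (d + 1)) (u' t : Site (d + 1)) :
    slotPsiS r n T κ (u + (n : ℤ) • t) κ' (u' + (n : ℤ) • t) = shiftK (-((n : ℤ) • t)) (slotPsiS r n T κ u κ' u') := by
  funext x z a b
  have eR : shiftK (-((n : ℤ) • t)) (slotPsiS r n T κ u κ' u') x z a b = slotPsiS r n T κ u κ' u' (x + -((n : ℤ) • t)) (z + -((n : ℤ) • t)) a b := rfl
  rw [eR, slotPsiS_apply_table, slotPsiS_apply_table]
  refine slotPsiS_translate hn r t (fun k v => ?_) κ u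
  rw [hTcov]; rfl

/-- [folklore] **THE INNER SLOT TRANSPORT KEEPS JOINT BLOCK COVARIANCE** of a bi-stencil table. -/
theorem slotPsiS_inner_translate (hTcov : ∀ κ u κ' u' t, T κ (u + (n : ℤ) • t) κ' (u' + (n : ℤ) • t) = shiftK (-((n : ℤ) • t)) (T κ u κ' u'))
    (κ : Fin (d + 1)) (u : Site (d + 1)) (κ' : Fin (d + 1)) (u' t : Site (d + 1)) :
    slotPsiS r n (T κ (u + (n : ℤ) • t)) κ' (u' + (n : ℤ) • t) = shiftK (-((n : ℤ) • t)) (slotPsiS r n (T κ u) κ' u') := by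
  funext x z a b
  have eR : shiftK (-((n : ℤ) • t)) (slotPsiS r n (T κ u) κ' u') x z a b = slotPsiS r n (T κ u) κ' u' (x + -((n : ℤ) • t)) (z + -((n : ℤ) • t)) a b := rfl
  rw [eR, slotPsiS_apply_kernel, slotPsiS_apply_kernel]
  refine slotPsiS_translate hn r t (fun k v => ?_) κ' u'
  rw [hTcov]; rfl

omit hn in
/-- [folklore] **THE LEG CONJUGATION BY A BLOCK-COVARIANT KERNEL COMMUTES WITH BLOCK SHIFTS**: `Ψ̂ᵀ ∘ shiftK (−n•t) X ∘ Ψ̂ = shiftK (−n•t) (Ψ̂ᵀ ∘ X ∘ Ψ̂)`. -/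
theorem conj_psiKS_shiftK {n : ℕ} (hn : 0 < n) (X : MKer (d + 1) (Fib d)) (t : Site (d + 1)) :
    comp (comp (trK (psiKS r n)) (shiftK (-((n : ℤ) • t)) X)) (psiKS r n) = shiftK (-((n : ℤ) • t)) (comp (comp (trK (psiKS r n)) X) (psiKS r n)) := by
  have hΨ : shiftK (-((n : ℤ) • t)) (psiKS r n) = psiKS r n := by rw [← smul_neg]; exact shiftK_psiKS hn (-t)
  conv_lhs => rw [← hΨ]
  rw [show trK (shiftK (-((n : ℤ) • t)) (psiKS r n)) = shiftK (-((n : ℤ) • t)) (trK (psiKS r n)) from rfl, comp_shiftK, comp_shiftK]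

/-- [folklore] **THE FOUR-SLOT TRANSPORT `𝒯₄` KEEPS JOINT BLOCK COVARIANCE** (`Ψ̂ = psiKS r n`, left-first bracketing). -/
theorem fourSlot_translate (hTcov : ∀ κ u κ' u' t, T κ (u + (n : ℤ) • t) κ' (u' + (n : ℤ) • t) = shiftK (-((n : ℤ) • t)) (T κ u κ' u'))
    (κ : Fin (d + 1)) (u : Site (d + 1)) (κ' : Fin (d + 1)) (u' t : Site (d + 1)) :
    comp (comp (trK (psiKS r n)) (slotPsiS r n (slotPsiS r n T κ (u + (n : ℤ) • t)) κ' (u' + (n : ℤ) • t))) (psiKS r n)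
      = shiftK (-((n : ℤ) • t)) (comp (comp (trK (psiKS r n)) (slotPsiS r n (slotPsiS r n T κ u) κ' u')) (psiKS r n)) := by
  rw [slotPsiS_inner_translate hn r (T := slotPsiS r n T) (slotPsiS_outer_translate hn r hTcov) κ u κ' u' t, conj_psiKS_shiftK r hn]

variable {r} (hr : r ∈ box (d + 1) n)
include hr

/-- [folklore] **THE `Ψ̂`-CONJUGATE OF A BI-LOCALISED KERNEL IS BI-LOCALISED** at the same points, rate `δ/4`, constant LINEAR in `C`: `cΨ₂(δ) · C` with
`cΨ₂(δ) := |F|·C_Ψ(δ/2)·(|F|·C_Ψ(δ)·Zl(δ/2))·Zl(δ/4)`, `C_Ψ(δ) = kerBound Ψ̂ n · e^{2δ(d+1)n}` the `decays_psiKS` constant (lit `biLoc_comp_decays` once per leg; the right leg through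
`trK_comp ∕ biLoc_trK`). -/
theorem biLoc_conj_psiKS {X : MKer (d + 1) (Fib d)} {p q : Site (d + 1)} {C δ : ℝ} (hX : BiLoc X p q C δ) (hδ : 0 < δ) :
    BiLoc (comp (comp (trK (psiKS r n)) X) (psiKS r n)) p q
      ((Fintype.card (Fib d) : ℝ) * (kerBound (psiKS r n) n * Real.exp (δ / 2 * (2 * (((d : ℝ) + 1) * n))) *
          ((Fintype.card (Fib d) : ℝ) * (kerBound (psiKS r n) n * Real.exp (δ * (2 * (((d : ℝ) + 1) * n))) * C) * Zl (d + 1) (δ - δ / 2))) *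
        Zl (d + 1) (δ / 2 - δ / 4)) (δ / 4) := by
  -- left leg: `Ψ̂ᵀ` decays at rate `δ`
  have hL := biLoc_comp_decays (decays_trK (decays_psiKS hn hr hδ.le)) hX (show (0 : ℝ) ≤ δ / 2 by positivity) (by linarith)
  -- right leg: transpose, compose with `Ψ̂ᵀ` at rate `δ/2`, transpose back
  have hR := biLoc_comp_decays (decays_trK (decays_psiKS hn hr (show (0 : ℝ) ≤ δ / 2 by positivity))) (biLoc_trK hL)
    (show (0 : ℝ) ≤ δ / 4 by positivity) (by linarith)
  have e : comp (comp (trK (psiKS r n)) X) (psiKS r n) = trK (comp (trK (psiKS r n)) (trK (comp (trK (psiKS r n)) X))) := by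
    rw [← trK_comp, trK_trK]
  rw [e]
  exact biLoc_trK hR

/-- [folklore] **THE LEG CONJUGATION KEEPS THE `LocStencil₂` CLASS** (rate `δ ↦ δ/4`, constant `cΨ₂(δ) · C`). -/
theorem locStencil₂_conj_psiKS {C δ : ℝ} (hT : LocStencil₂ T C δ) (hδ : 0 < δ) :
    LocStencil₂ (fun κ u κ' u' => comp (comp (trK (psiKS r n)) (T κ u κ' u')) (psiKS r n))
      ((Fintype.card (Fib d) : ℝ) * (kerBound (psiKS r n) n * Real.exp (δ / 2 * (2 * (((d : ℝ) + 1) * n))) *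
          ((Fintype.card (Fib d) : ℝ) * (kerBound (psiKS r n) n * Real.exp (δ * (2 * (((d : ℝ) + 1) * n))) * C) * Zl (d + 1) (δ - δ / 2))) *
        Zl (d + 1) (δ / 2 - δ / 4)) (δ / 4) := by
  intro κ u κ' u'
  have hC : 0 ≤ C := hT.nonneg
  have hk : 0 ≤ kerBound (psiKS r n) n := ((decays_psiKS hn hr le_rfl).nonneg (Sum.inl 0)).trans_eq (by rw [zero_mul, Real.exp_zero, mul_one])
  have h := biLoc_conj_psiKS hn hr (hT κ u κ' u') hδ
  have hZ1 := Zl_nonneg (D := d + 1) (show (0 : ℝ) < δ - δ / 2 by linarith)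
  have hZ2 := Zl_nonneg (D := d + 1) (show (0 : ℝ) < δ / 2 - δ / 4 by linarith)
  refine biLoc_le_mono h (by positivity) ?_ le_rfl
  have hexp : Real.exp (-δ * l1 (u' - u)) ≤ Real.exp (-(δ / 4) * l1 (u' - u)) := Real.exp_le_exp.2 (by nlinarith [l1_nonneg (u' - u)])
  have h4 : 0 ≤ (Fintype.card (Fib d) : ℝ) * (kerBound (psiKS r n) n * Real.exp (δ / 2 * (2 * (((d : ℝ) + 1) * n))) *
      ((Fintype.card (Fib d) : ℝ) * (kerBound (psiKS r n) n * Real.exp (δ * (2 * (((d : ℝ) + 1) * n))) * C) * Zl (d + 1) (δ - δ / 2))) *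
        Zl (d + 1) (δ / 2 - δ / 4) := by positivity
  calc (Fintype.card (Fib d) : ℝ) * (kerBound (psiKS r n) n * Real.exp (δ / 2 * (2 * (((d : ℝ) + 1) * n))) *
          ((Fintype.card (Fib d) : ℝ) * (kerBound (psiKS r n) n * Real.exp (δ * (2 * (((d : ℝ) + 1) * n))) * (C * Real.exp (-δ * l1 (u' - u)))) *
            Zl (d + 1) (δ - δ / 2))) * Zl (d + 1) (δ / 2 - δ / 4)
      = (Fintype.card (Fib d) : ℝ) * (kerBound (psiKS r n) n * Real.exp (δ / 2 * (2 * (((d : ℝ) + 1) * n))) *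
          ((Fintype.card (Fib d) : ℝ) * (kerBound (psiKS r n) n * Real.exp (δ * (2 * (((d : ℝ) + 1) * n))) * C) * Zl (d + 1) (δ - δ / 2))) *
            Zl (d + 1) (δ / 2 - δ / 4) * Real.exp (-δ * l1 (u' - u)) := by ring
    _ ≤ _ := mul_le_mul_of_nonneg_left hexp h4

/-- [folklore] **THE FOUR-SLOT TRANSPORT `𝒯₄` KEEPS THE `LocStencil₂` CLASS** (rate `δ ↦ δ/4`; TT5 `locStencil₂_slotPsiS₂` for the slots, `locStencil₂_conj_psiKS` for the legs). -/
theorem locStencil₂_fourSlot {C δ : ℝ} (hT : LocStencil₂ T C δ) (hδ : 0 < δ) :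
    ∃ C' : ℝ, LocStencil₂ (fun κ₁ u₁ κ₂ u₂ => comp (comp (trK (psiKS r n)) (slotPsiS r n (slotPsiS r n T κ₁ u₁) κ₂ u₂)) (psiKS r n)) C' (δ / 4) :=
  ⟨_, locStencil₂_conj_psiKS hn hr (locStencil₂_slotPsiS₂ hn r hT hδ.le) hδ⟩

end Generic

/-! ## §1 At the comb data (`n = Lc`, `Ψ̂_S = psiKS (ctrOff (d+1) Lc) Lc`, `ρ_c = ctr (d+1) Lc`): the comb step is the rooted bm step on the transported table -/

section Comb

variable {Lc : ℕ} [NeZero Lc]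

omit [NeZero Lc] in
/-- [folklore] `0 < Lc` for a `NeZero` block side. -/
theorem pos_of_neZero [NeZero Lc] : 0 < Lc := Nat.pos_of_ne_zero (NeZero.ne Lc)

variable {T : Fin (d + 1) → Site (d + 1) → Fin (d + 1) → Site (d + 1) → MKer (d + 1) (Fib d)} {CT δT : ℝ}

/-- **THE COMB-CHART LINEAR STEP IS THE ROOTED bm-CHART LINEAR STEP ON THE TRANSPORTED TABLE** [our bookkeeping; folklore composition]: for every level `j`, scalar `c` and `LocStencil₂`
table `T` (rate `> 0`),
`lin4 c (unitK_j (GcombSh Lc j)) Lc T = lin4 c (unitK_j (coDressKBmAt ρ_c Lc (KInvStep Lc j))) Lc (𝒯₄ T)`, `𝒯₄ T κ₁ u₁ κ₂ u₂ := Ψ̂_Sᵀ ∘ slotPsiS (slotPsiS T κ₁ u₁) κ₂ u₂ ∘ Ψ̂_S`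
— an2's chart transport `CombChartTransportLevel.GcombSh_eq_conj_psiKS_KInvStep` (every `j`) ⨾ leaf-03's `CombLin4Transport.unitK_conj_psiKS` ⨾ (C-1) `lin4_conj_psiKS`. -/
theorem lin4_unitK_GcombSh_eq_fourSlot (j : ℕ) (c : ℝ) (hT : LocStencil₂ T CT δT) (hδT : 0 < δT)
    (κ : Fin (d + 1)) (u : Site (d + 1)) (κ' : Fin (d + 1)) (u' : Site (d + 1)) :
    lin4 c (unitK (sfStep Lc j) (smStep d Lc j) (GcombSh (d := d) Lc j)) Lc T κ u κ' u'
      = lin4 c (unitK (sfStep Lc j) (smStep d Lc j) (coDressKBmAt (ctr (d + 1) Lc) Lc (KInvStep (d := d) Lc j))) Lc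
          (fun κ₁ u₁ κ₂ u₂ => comp (comp (trK (psiKS (ctrOff (d + 1) Lc) Lc))
            (slotPsiS (ctrOff (d + 1) Lc) Lc (slotPsiS (ctrOff (d + 1) Lc) Lc T κ₁ u₁) κ₂ u₂)) (psiKS (ctrOff (d + 1) Lc) Lc)) κ u κ' u' := by
  have hLc : 0 < Lc := pos_of_neZero
  have hr : ctrOff (d + 1) Lc ∈ box (d + 1) Lc := ctrOff_mem_box hLc
  obtain ⟨δ, C, hδ, -, hG⟩ := decays_coDressKBmAt_KInvStep (d := d) (Lc := Lc) hr j
  have hK : Spr (unitK (sfStep Lc j) (smStep d Lc j) (coDressKBmAt (ctr (d + 1) Lc) Lc (KInvStep (d := d) Lc j))) :=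
    ⟨_, δ, hδ, decays_unitK (sf := sfStep Lc j) (sm := smStep d Lc j) hG⟩
  rw [GcombSh_eq_conj_psiKS_KInvStep Lc j, unitK_conj_psiKS, lin4_conj_psiKS hLc hr hK hT hδT]

/-- **… WITH THE DRESSING MOVED ONTO THE TRANSPORTED TABLE** [our bookkeeping; folklore composition]: for every level `j`, scalar `c` and `LocStencil₂` table `T` (rate `> 0`),
`lin4 c (unitK_j (GcombSh Lc j)) Lc T = lin4 c (unitK_j (KInvStep Lc j)) Lc (𝔇_{ρ_c} (𝒯₄ T))`, `𝔇_{ρ} X := κ u κ′ u′ ↦ dressKBmAt ρ Lc (coProjBmAtK ρ Lc (κ₁ u₁ ↦ coProjBmAtK ρ Lc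
(X κ₁ u₁) κ′ u′) κ u)` (leaf-06's leg-and-slot dressing, the lambda of `LinT2CoDressedStep.lin4_comb_coDressKBmAt` VERBATIM, at the centre root) — §1 ⨾ leaf-06's
`lin4_comb_coDressKBmAt` on `𝒯₄ T` (`LocStencil₂` by §0).  This is the shape of road-P2's `T2RecChargeStep.succ_eq_lin4_dress_add` for the comb chart: the comb step is the UNDRESSED
step on the dressed, transported member. -/
theorem lin4_unitK_GcombSh_eq_lin4_dress_fourSlot (j : ℕ) (c : ℝ) (hT : LocStencil₂ T CT δT) (hδT : 0 < δT) :
    lin4 c (unitK (sfStep Lc j) (smStep d Lc j) (GcombSh (d := d) Lc j)) Lc T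
      = lin4 c (unitK (sfStep Lc j) (smStep d Lc j) (KInvStep (d := d) Lc j)) Lc
          (fun κ u κ' u' => dressKBmAt (ctr (d + 1) Lc) Lc (coProjBmAtK (ctr (d + 1) Lc) Lc (fun κ₁ u₁ => coProjBmAtK (ctr (d + 1) Lc) Lc
            ((fun κ₂ u₂ κ₃ u₃ => comp (comp (trK (psiKS (ctrOff (d + 1) Lc) Lc))
              (slotPsiS (ctrOff (d + 1) Lc) Lc (slotPsiS (ctrOff (d + 1) Lc) Lc T κ₂ u₂) κ₃ u₃)) (psiKS (ctrOff (d + 1) Lc) Lc)) κ₁ u₁) κ' u') κ u)) := by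
  have hLc : 0 < Lc := pos_of_neZero
  obtain ⟨C', hT₄⟩ := locStencil₂_fourSlot hLc (ctrOff_mem_box hLc) hT hδT
  have e : lin4 c (unitK (sfStep Lc j) (smStep d Lc j) (GcombSh (d := d) Lc j)) Lc T
      = lin4 c (unitK (sfStep Lc j) (smStep d Lc j) (coDressKBmAt (ctr (d + 1) Lc) Lc (KInvStep (d := d) Lc j))) Lc
          (fun κ₁ u₁ κ₂ u₂ => comp (comp (trK (psiKS (ctrOff (d + 1) Lc) Lc))
            (slotPsiS (ctrOff (d + 1) Lc) Lc (slotPsiS (ctrOff (d + 1) Lc) Lc T κ₁ u₁) κ₂ u₂)) (psiKS (ctrOff (d + 1) Lc) Lc)) := by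
    funext κ u κ' u'
    exact lin4_unitK_GcombSh_eq_fourSlot j c hT hδT κ u κ' u'
  rw [e]
  exact lin4_comb_coDressKBmAt (r := ctrOff (d + 1) Lc) (ctrOff_mem_box hLc) j hT₄ (by positivity) c

/-! ## §2 The comb-chart `T₂` tower: its four-slot transport carries the SAME cell charges, at every level -/

/-- **THE FOUR-SLOT TRANSPORT OF THE COMB-CHART MEMBER HAS THE SAME TRANSVERSAL INNER SUMS** [our bookkeeping; folklore composition]: for ANY sym record `tabs : SymTables d Lc`,
all constants, every level `j`, every first bond `(κ, u)`, second direction `κ′` and EVERY leg pair `(a, b)` — with `T̃′♮_j := unitS₂_j (T2RecOf d Lc (GcombSh Lc) (SpureCombOf tabs cE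
cVH cΛ) tabs.M cE₂ cB Tc tabs.vh₂S tabs.mixFF j)` (a `LocStencil₂` jointly `Lc`-covariant table: leaf-01 g80's `CombRelSourceHalfCharge.locStencil₂_unitS₂_T2RecOf_comb`, the OWNER g46's
`CombT2DriftEvenEnd.unitS₂_T2RecOf_comb_translate`) — `Σ'_{u′xz} (𝒯₄ T̃′♮_j) κ u κ′ u′ x z a b = Σ'_{u′xz} T̃′♮_j κ u κ′ u′ x z a b` (`SymCorrectorZeroMode.inner_fourSlot_eq`). -/
theorem inner_fourSlot_comb_member_eq (tabs : SymTables d Lc) (cE cVH cΛ cE₂ cB : ℝ) (Tc : Fin 4 → Fin 4 → Fin 4 → Fin 4 → ℝ) (j : ℕ)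
    (κ : Fin (d + 1)) (u : Site (d + 1)) (κ' : Fin (d + 1)) (a b : Fib d) :
    (∑' u', ∑' x, ∑' z, comp (comp (trK (psiKS (ctrOff (d + 1) Lc) Lc))
        (slotPsiS (ctrOff (d + 1) Lc) Lc (slotPsiS (ctrOff (d + 1) Lc) Lc
          (unitS₂ (sfStep Lc j) (smStep d Lc j) (T2RecOf d Lc (GcombSh Lc) (SpureCombOf tabs cE cVH cΛ) tabs.M cE₂ cB Tc tabs.vh₂S tabs.mixFF j)) κ u) κ' u'))
        (psiKS (ctrOff (d + 1) Lc) Lc) x z a b)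
      = ∑' u', ∑' x, ∑' z, (unitS₂ (sfStep Lc j) (smStep d Lc j)
          (T2RecOf d Lc (GcombSh Lc) (SpureCombOf tabs cE cVH cΛ) tabs.M cE₂ cB Tc tabs.vh₂S tabs.mixFF j)) κ u κ' u' x z a b := by
  obtain ⟨C, δ, hδ, hT⟩ := locStencil₂_unitS₂_T2RecOf_comb tabs cE cVH cΛ cE₂ cB Tc j
  exact inner_fourSlot_eq pos_of_neZero (ctrOff_mem_box pos_of_neZero) hT hδ (unitS₂_T2RecOf_comb_translate tabs cE cVH cΛ cE₂ cB Tc j) κ u κ' a b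

/-- **THE FOUR-SLOT TRANSPORT OF THE COMB-CHART MEMBER HAS THE SAME CELL CHARGES** [our bookkeeping; folklore composition]: `zmode N (𝒯₄ T̃′♮_j) κ κ′ a b = zmode N (T̃′♮_j) κ κ′ a b`
for every period `N`, every level `j`, every direction pair and EVERY leg pair — in particular the bond-symmetrised field–field charge `zmodeSym_Lc` of the (III′) conservation row (d′)
(`CombChargeConservationRow`) is the same on the member and on its transport.  NO value of either charge is asserted. -/
theorem zmode_fourSlot_comb_member_eq (tabs : SymTables d Lc) (cE cVH cΛ cE₂ cB : ℝ) (Tc : Fin 4 → Fin 4 → Fin 4 → Fin 4 → ℝ) (N j : ℕ)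
    (κ κ' : Fin (d + 1)) (a b : Fib d) :
    zmode N (fun κ₁ u₁ κ₂ u₂ => comp (comp (trK (psiKS (ctrOff (d + 1) Lc) Lc))
        (slotPsiS (ctrOff (d + 1) Lc) Lc (slotPsiS (ctrOff (d + 1) Lc) Lc
          (unitS₂ (sfStep Lc j) (smStep d Lc j) (T2RecOf d Lc (GcombSh Lc) (SpureCombOf tabs cE cVH cΛ) tabs.M cE₂ cB Tc tabs.vh₂S tabs.mixFF j)) κ₁ u₁) κ₂ u₂))
        (psiKS (ctrOff (d + 1) Lc) Lc)) κ κ' a b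
      = zmode N (unitS₂ (sfStep Lc j) (smStep d Lc j)
          (T2RecOf d Lc (GcombSh Lc) (SpureCombOf tabs cE cVH cΛ) tabs.M cE₂ cB Tc tabs.vh₂S tabs.mixFF j)) κ κ' a b := by
  obtain ⟨C, δ, hδ, hT⟩ := locStencil₂_unitS₂_T2RecOf_comb tabs cE cVH cΛ cE₂ cB Tc j
  exact zmode_fourSlot_eq pos_of_neZero (ctrOff_mem_box pos_of_neZero) hT hδ (unitS₂_T2RecOf_comb_translate tabs cE cVH cΛ cE₂ cB Tc j) N κ κ' a b

end Comb

end Summit.QuantumFields.BalabanUV.Beta.GAN24.CombTransportZeroMode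

end
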